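import Summits.BirchSwinnertonDyer.BirchSwinnertonDyer.Theorems.GenusKolyvaginAtTwoPowDvdShaCardAtTwoRTHalfTransverseOfValues
import HarnessLib

/-!
# Route `GenusKolyvaginAtTwo`, crux L_T `PowDvdShaCardAtTwoRT` (stmt-BirchSwinnertonDyer-23242), LINE 18 stub L, bottom rung
# (index-`≥ 2` engine), input (iii) at ODD depth: the (iii)-SOCKET for the TWIN `E^{(c)}` through `hPsiKT`

Seat `bsd-line-gk2-p3` g21 (PROVER seat 3/3, cell `bsd-f1-sign2`), `--supports 23242 --as helper`.  THEOREMS ONLY; no `sorry`.  Sequel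
to `…RTHalfTransverseOfValues` (p704347).  BSD is NOT proved by any of this; neither is the crux nor stub L.

WHY (LEAD 06:36:57Z «odd-depth (twin/hPsiKT) variants»).  At odd depth the engine's class `Z = desc c₂(nℓ′)` lives in `H¹(ℚ, E^{(c)}[4])`
(`c = d_K`): the `K`-class `c_M(nℓ′) ∈ H¹(K, E_K[4])` of the `τ`-ANTI-fixed sign descends to the twin through the `K`-isomorphism
`E^{(c)}_K ≅ E_K` (`hPsiKT : H¹(K, E^{(c)}_K[n]) ≃+ H¹(K, E_K[n])`, `psiKT` on points — Literature `SelmerTorsionTwistRestriction`).  The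
(iii)-socket `halfTransverse_of_resTorsion_values` is stated for `resTorsion W K`; for the twin the line relation is known for
`hPsiKT (resTorsion (W.quadraticTwist c) K x)` (that is where the Kolyvagin class lives), so one transport through `psiKT` is needed:
* `mem_torsionFixing_twist_baseChange_iff` — `Γ_{K(E^{(c)}_K[n])} = Γ_{K(E_K[n])}` (`psiKT` equivariant bijection);
* **`h1Eval_hPsiKT`** — `[hPsiKT y, ρ] = psiKT [y, ρ]` for `ρ ∈ Γ_{K(E_K[n])}` (`hPsiKT_apply` = `resH1Hom (id, psiKT)`,
  `resH1Hom_id_oneCocycleClass`, `h1Eval_oneCocycleClass`);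
* `exists_h1Eval_resTorsion_eq_zsmul_of_hPsiKT` — a line relation `[hPsiKT (res x), g]_K ∈ ℤ·[hPsiKT (res x), σ]_K` is the same relation
  for `res x` (`psiKT` injective);
* **`halfTransverse_twist_of_hPsiKT_resTorsion_values`** — the (iii)-socket for `x ∈ H¹(ℚ, E^{(c)}[2^M])`: `g₂, σ₁ ∈ Γ_{K(E_K[2^M])}`,
  `res g₂ = F²`, `res σ₁ ∈ I_𝔓`, `[hPsiKT (res x), g₂]_K ∈ ℤ·[hPsiKT (res x), σ₁]_K` ⟹ `x` is HALF-TRANSVERSE at `F` (for the Galois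
  module `E^{(c)}[2^M]`, regular data of the twin — on `Δ < 0` the twin has `Δ(E^{(c)}) = c⁶Δ < 0` and the same Gross–Kolyvagin primes,
  `…TwinGrossPrimes`), i.e. the hypothesis of `…RTHalfTransverseIsotropicPackaged` / `…HalfTransverseLocalPackaged` /
  gk2-p4 `…RTDeepOwnPrimeCondition` applied to `W.quadraticTwist c`.
HONEST FRAMING: transport only; the value law itself is `…RTOwnPrimeValuesOfDatum` (displayed reduction datum).  BSD is NOT proved.

References: [McCallumLMS1991] §4 Prop. 4.4 (1); [SilvermanAEC2009] X.§4, X.5 Cor. 5.4; [SerreGaloisCohomology1997] I §2.4.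
-/

set_option autoImplicit false
set_option linter.dupNamespace false -- tree convention: `Summit.BirchSwinnertonDyer.BirchSwinnertonDyer.Theorems` (summit = sub-problem)

noncomputable section
open scoped Classical Pointwise

namespace Summit.BirchSwinnertonDyer.BirchSwinnertonDyer.Theorems.GenusExact.TransverseIsotropy

open WeierstrassCurve NumberField IsDedekindDomain Field
open Literature.NumberTheory.EllipticCurves Literature.NumberTheory.GaloisRepresentations
open Literature.NumberTheory.GaloisCohomology

section Twist

variable (W : WeierstrassCurve ℚ) (K : Type) [Field K] [NumberField K] {θ : K} {c : ℚ}

/-- **`Γ_{K(E^{(c)}_K[n])} = Γ_{K(E_K[n])}`**: an element of `Γ_K` fixes `E^{(c)}_K[n]` iff it fixes `E_K[n]` (`psiKT` is an equivariant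
bijection). [cite: SilvermanAEC2009, X.5 Cor. 5.4] -/
theorem mem_torsionFixing_twist_baseChange_iff (hθ : θ ∉ Set.range (algebraMap ℚ K)) (hc : θ ^ 2 = algebraMap ℚ K c) (n : ℤ)
    (ρ : absoluteGaloisGroup K) :
    ρ ∈ torsionFixing ((W.quadraticTwist c).baseChange K) n ↔ ρ ∈ torsionFixing (W.baseChange K) n := by
  rw [mem_torsionFixing_iff, mem_torsionFixing_iff]
  constructor
  · intro h P
    obtain ⟨m, rfl⟩ := (psiKT W K hθ hc n).surjective P
    rw [← psiKT_smul, h m]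
  · intro h m
    apply (psiKT W K hθ hc n).injective
    rw [psiKT_smul, h]

/-- **`[hPsiKT y, ρ] = psiKT [y, ρ]`** for `ρ ∈ Γ_{K(E_K[n])}`: `hPsiKT = H¹(id, psiKT)` (`hPsiKT_apply`), and the chosen cocycle of
`H¹(id, ψ)[φ] = [ψ ∘ φ]` agrees with `ψ ∘ φ` at elements fixing the torsion (`h1Eval_oneCocycleClass`). [cite: SerreGaloisCohomology1997, I §2.4] -/
theorem h1Eval_hPsiKT (hθ : θ ∉ Set.range (algebraMap ℚ K)) (hc : θ ^ 2 = algebraMap ℚ K c) (n : ℤ)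
    (y : galH1Torsion ((W.quadraticTwist c).baseChange K) n) {ρ : absoluteGaloisGroup K}
    (hρ : ρ ∈ torsionFixing (W.baseChange K) n) :
    h1Eval (W.baseChange K) n (hPsiKT W K hθ hc n y) ρ =
      psiKT W K hθ hc n (h1Eval ((W.quadraticTwist c).baseChange K) n y ρ) := by
  have hρ' : ρ ∈ torsionFixing ((W.quadraticTwist c).baseChange K) n :=
    (mem_torsionFixing_twist_baseChange_iff W K hθ hc n ρ).mpr hρ
  obtain ⟨φ, rfl⟩ := oneCocycleClass_surjective _ y
  rw [hPsiKT_apply, resH1Hom_id_oneCocycleClass, h1Eval_oneCocycleClass _ _ _ hρ, contOneCocycles.push_apply,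
    h1Eval_oneCocycleClass _ _ _ hρ']
  rfl

/-- **A line relation for `hPsiKT (res x)` is the same relation for `res x`** (`psiKT` injective). [folklore] -/
theorem exists_h1Eval_resTorsion_eq_zsmul_of_hPsiKT (hθ : θ ∉ Set.range (algebraMap ℚ K)) (hc : θ ^ 2 = algebraMap ℚ K c) (n : ℤ)
    (x : galH1Torsion (W.quadraticTwist c) n)
    {g σ : absoluteGaloisGroup K} (hg : g ∈ torsionFixing (W.baseChange K) n) (hσ : σ ∈ torsionFixing (W.baseChange K) n)
    (h : ∃ k : ℤ, h1Eval (W.baseChange K) n (hPsiKT W K hθ hc n (resTorsion (W.quadraticTwist c) K n x)) g =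
      k • h1Eval (W.baseChange K) n (hPsiKT W K hθ hc n (resTorsion (W.quadraticTwist c) K n x)) σ) :
    ∃ k : ℤ, h1Eval ((W.quadraticTwist c).baseChange K) n (resTorsion (W.quadraticTwist c) K n x) g =
      k • h1Eval ((W.quadraticTwist c).baseChange K) n (resTorsion (W.quadraticTwist c) K n x) σ := by
  obtain ⟨k, hk⟩ := h
  refine ⟨k, (psiKT W K hθ hc n).injective ?_⟩
  rw [map_zsmul, ← h1Eval_hPsiKT W K hθ hc n _ hg, ← h1Eval_hPsiKT W K hθ hc n _ hσ, hk]

end Twist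

/-! ## The (iii)-socket for the twin -/

section Socket

variable {v : HeightOneSpectrum (𝓞 ℚ)} (W : WeierstrassCurve ℚ) (K : Type) [Field K] [NumberField K] {θ : K} {c : ℚ}

/-- **(iii)-SOCKET for the twin `E^{(c)}`** (odd depth).  Setting of `halfTransverse_of_resTorsion_values` for the curve `W^{(c)} = W.quadraticTwist c`
over `ℚ` (`q = 2^M`, `M ≥ 2`; `F` a regular involutive Frobenius on `E^{(c)}[q]` at the prime `𝔓` of the chosen embedding, inverting `μ_q`;
`I_𝔓` fixing `E^{(c)}[q]`); `g₂, σ₁ ∈ Γ_{K(E_K[q])}` with `res g₂ = F²`, `res σ₁ ∈ I_𝔓`; and the line relation for the `K`-class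
**`hPsiKT (res x) ∈ H¹(K, E_K[q])`** (where the Kolyvagin class `c_M(m)` lives): `[hPsiKT (res x), g₂]_K ∈ ℤ·[hPsiKT (res x), σ₁]_K`.  Then
`x ∈ H¹(ℚ, E^{(c)}[q])` is HALF-TRANSVERSE at `F`. [cite: McCallumLMS1991, §4 Prop. 4.4 (1)] [cite: SilvermanAEC2009, X.5 Cor. 5.4] -/
theorem halfTransverse_twist_of_hPsiKT_resTorsion_values (hθ : θ ∉ Set.range (algebraMap ℚ K))
    (hc : θ ^ 2 = algebraMap ℚ K c) [(W.quadraticTwist c).IsElliptic] {M q : ℕ} (hM : 2 ≤ M) (hq : q = 2 ^ M)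
    (hqv : (q : 𝓞 ℚ) ∉ v.asIdeal)
    {𝔐 : Ideal (HeightOneSpectrum.localAbsIntegers v)} (h𝔐 : 𝔐 ∈ v.localPrimesAbove)
    {F : absoluteGaloisGroup ℚ}
    (hFrob : IsArithFrobAt (𝓞 ℚ) F (v.primeBelow (closureEmb (K := ℚ) (v.adicCompletion ℚ)) 𝔐))
    (hFμ : ∀ ζ : AlgebraicClosure ℚ, ζ ^ q = 1 → F • ζ = ζ⁻¹)
    (hF : ∀ Q : geomTorsion (W.quadraticTwist c) (q : ℤ), F • F • Q = Q)
    {P : geomTorsion (W.quadraticTwist c) (q : ℤ)} (hPM : (2 : ℤ) ^ M • P = 0)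
    (hgen : ∀ Q : geomTorsion (W.quadraticTwist c) (q : ℤ), ∃ x y : ℤ, Q = x • P + y • F • P)
    (hfree : ∀ x y : ℤ, x • P + y • F • P = 0 → (2 : ℤ) ^ M ∣ x ∧ (2 : ℤ) ^ M ∣ y)
    (hI : (v.primeBelow (closureEmb (K := ℚ) (v.adicCompletion ℚ)) 𝔐).inertia (absoluteGaloisGroup ℚ) ≤
      torsionFixing (W.quadraticTwist c) (q : ℤ))
    {x : galH1Torsion (W.quadraticTwist c) (q : ℤ)} {g₂ σ₁ : absoluteGaloisGroup K}
    (hg₂ : g₂ ∈ torsionFixing (W.baseChange K) (q : ℤ)) (hσ₁ : σ₁ ∈ torsionFixing (W.baseChange K) (q : ℤ))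
    (hg₂F : resGal (K := ℚ) K g₂ = F * F)
    (hσ₁I : resGal (K := ℚ) K σ₁ ∈ (v.primeBelow (closureEmb (K := ℚ) (v.adicCompletion ℚ)) 𝔐).inertia (absoluteGaloisGroup ℚ))
    (hval : ∃ k : ℤ, h1Eval (W.baseChange K) (q : ℤ) (hPsiKT W K hθ hc (q : ℤ) (resTorsion (W.quadraticTwist c) K (q : ℤ) x)) g₂ =
      k • h1Eval (W.baseChange K) (q : ℤ) (hPsiKT W K hθ hc (q : ℤ) (resTorsion (W.quadraticTwist c) K (q : ℤ) x)) σ₁) :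
    ∃ P₁ Q₁ : geomTorsion (W.quadraticTwist c) (q : ℤ), h1Eval (W.quadraticTwist c) (q : ℤ) x F = (F • P₁ - P₁) + (2 : ℕ) • Q₁ := by
  have hval' := exists_h1Eval_resTorsion_eq_zsmul_of_hPsiKT W K hθ hc (q : ℤ) x hg₂ hσ₁ hval
  have hg₂' : g₂ ∈ torsionFixing ((W.quadraticTwist c).baseChange K) (q : ℤ) :=
    (mem_torsionFixing_twist_baseChange_iff W K hθ hc (q : ℤ) g₂).mpr hg₂
  have hσ₁' : σ₁ ∈ torsionFixing ((W.quadraticTwist c).baseChange K) (q : ℤ) :=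
    (mem_torsionFixing_twist_baseChange_iff W K hθ hc (q : ℤ) σ₁).mpr hσ₁
  exact halfTransverse_of_resTorsion_values (W.quadraticTwist c) K hM hq hqv h𝔐 hFrob hFμ hF hPM hgen hfree hI hg₂' hσ₁' hg₂F
    hσ₁I hval'

end Socket

end Summit.BirchSwinnertonDyer.BirchSwinnertonDyer.Theorems.GenusExact.TransverseIsotropy

end
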